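import Literature.MathematicalPhysics.QuantumLattice.KomaTasakiGriffithsTheoremProofs
import Literature.MathematicalPhysics.QuantumLattice.XXZIsingAntiferromagnetThermalSpontaneousOrder
import HarnessLib

/-!
# KT93 Theorem 2.1 in ONE finite volume: a certified thermal long-range-order number on a torus gives an
# explicit floor on the sourced order parameter of the Gibbs state of `H - B·O` on that torus (`T > 0`)

T. Koma, H. Tasaki, *Symmetry breaking in Heisenberg antiferromagnets*, Commun. Math. Phys. **158** (1993) 191–214
(`KomaTasaki1993`), Theorem 2.1 and its proof, §4 (4.6) and §5 (5.3):

> (4.6) `f_Λ(0) ≤ f_Λ(B) - B ∂f_Λ(B)/∂B = f_Λ(B) + B N⁻¹⟨O_Λ⟩_Λ(B)`;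
> (5.3) `N^{-2k}⟨(O_Λ)^{2k}⟩_Λ(0) ≤ m^{2k} + 2ō^{2k}e^{-βNδ}e^{βh̄√N} + 2rk4^kō^{2k}N^{-1/4}`.

The tree proves (5.3) for one finite `ℤ₂` system with all constants explicit and the auxiliary parameters free
(`KomaTasaki.Z2System.moment_le_finiteVolume`: for `β > 0`, `B ≥ 0`, any real `m`, any `k`, `ℓ > 0`, `K ≥ 1`,
`N^{-2k}⟨O^{2k}⟩(0) ≤ m^{2k} + 32k³(2rh̄)²ō^{2k}K²/ℓ² + 2ō^{2k}/K + 2ō^{2k}e^{βℓ}exp(-βN[Bm + f_Λ(B) - f_Λ(0)])`),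
and (4.6) (`KomaTasaki.Z2System.freeEnergy_zero_le`), and assembles the printed LIMIT statement (2.13)
(`kt93_theorem_2_1_holds`, `…Subsequence`).  This file records the ONE-VOLUME consequence, which is the form a
finite computation can feed: choosing `m = (f_Λ(0) - f_Λ(B))/B + t` — a number in `[t, m_Λ(B) + t]` by (4.6) and
`f_Λ(B) ≤ f_Λ(0)` — the exponent in (5.3) is EXACTLY `-βNBt`, whence, on the SAME finite system, for every `B > 0`,
`t ≥ 0`, `ℓ > 0`, `K ≥ 1`:

  `N^{-2k}⟨(O_Λ)^{2k}⟩_Λ(0) ≤ (m_Λ(B) + t)^{2k} + 32k³(2rh̄)²ō^{2k}K²/ℓ² + 2ō^{2k}/K + 2ō^{2k}e^{βℓ - βNBt}`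

(`Z2System.moment_le_magnetisation_add_pow`), and the `k = 1` CERTIFICATE form: a number `s ≤ N⁻²⟨O_Λ²⟩_Λ(0)`
gives `m_Λ(B) ≥ √(s - E) - t`, `E = 32(2rh̄)²ō²K²/ℓ² + 2ō²/K + 2ō²e^{βℓ-βNBt}` (`Z2System.sqrt_sub_le_magnetisation_add`).
Instances (dictionaries of the tree's concrete `ℤ₂` systems): the planar XXZ model / hard-core bosons
(`XXZKT.z2System`, `O = Sʸ_tot`), the XXZ antiferromagnet with the staggered planar (`XXZKT.afZ2System`,
`O = Σ(-1)^xSˣ_x`) and Néel (`XXZKT.isingAFZ2System`, `O = Σ(-1)^xSᶻ_x`) order parameters; Koma's `π`-flux BCS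
lattice-fermion model is in `KomaPiFluxThermalFiniteVolumeFieldBound.lean`.

No definitions, no named facts, no sorry; no limit is taken anywhere in this file.

## References
* [KomaTasaki1993] T. Koma, H. Tasaki, Commun. Math. Phys. **158** (1993) 191–214, Theorem 2.1, §4 (4.5)–(4.7), §5 (5.3).
* [Tasaki2020] H. Tasaki, *Physics and Mathematics of Quantum Many-Body Systems*, Springer GTP (2020), §4.3.
-/

noncomputable section

namespace Literature.MathematicalPhysics.QuantumLattice

open _root_.Matrix Finset Filter Topology
open Literature.Probability.LatticeModels
open scoped Matrix.Norms.L2Operator ComplexConjugate ComplexOrder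

/-! ### §1. The abstract one-volume bound for a Koma–Tasaki `ℤ₂` system -/

namespace KomaTasaki.Z2System

variable {N : ℕ} {hb ob : ℝ} {r : ℕ} {n : Type*} [Fintype n] [DecidableEq n] (sys : Z2System N hb ob r n)

/-- `0 ≤ (f_Λ(0) - f_Λ(B))/B` for `B > 0` (`f_Λ(B) ≤ f_Λ(0)`, the free energy is even and concave in `B`).
[cite: KomaTasaki1993, §4 (4.5)–(4.7)] -/
theorem freeEnergy_sub_div_nonneg [Nonempty n] {β : ℝ} (hβ : 0 < β) {B : ℝ} (hB : 0 < B) :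
    0 ≤ (sys.freeEnergy β 0 - sys.freeEnergy β B) / B :=
  div_nonneg (sub_nonneg.mpr (sys.freeEnergy_le_freeEnergy_zero hβ B)) hB.le

/-- **(4.6) divided by `B > 0`**: `(f_Λ(0) - f_Λ(B))/B ≤ m_Λ(B)`. [cite: KomaTasaki1993, §4 (4.6)] -/
theorem freeEnergy_sub_div_le_magnetisation [Nonempty n] {β : ℝ} (hβ : 0 < β) {B : ℝ} (hB : 0 < B) :
    (sys.freeEnergy β 0 - sys.freeEnergy β B) / B ≤ sys.magnetisation β B := by
  rw [div_le_iff₀ hB]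
  have := sys.freeEnergy_zero_le hβ B
  linarith

/-- The sourced order parameter is non-negative for `B > 0`: `0 ≤ m_Λ(B)`. [cite: KomaTasaki1993, §4 (4.5)–(4.7)] -/
theorem magnetisation_nonneg [Nonempty n] {β : ℝ} (hβ : 0 < β) {B : ℝ} (hB : 0 < B) :
    0 ≤ sys.magnetisation β B :=
  (sys.freeEnergy_sub_div_nonneg hβ hB).trans (sys.freeEnergy_sub_div_le_magnetisation hβ hB)

/-- **KT93 THEOREM 2.1 IN ONE FINITE VOLUME (all `k`, explicit constants, free auxiliary parameters).**  For a
Koma–Tasaki `ℤ₂` system on `N ≥ 1` sites, `β > 0`, a field `B > 0`, a slack `t ≥ 0`, any `k`, block width `ℓ > 0`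
and sub-division number `K ≥ 1`:
`N^{-2k}⟨(O_Λ)^{2k}⟩_Λ(0) ≤ (m_Λ(B) + t)^{2k} + 32k³(2rh̄)²ō^{2k}K²/ℓ² + 2ō^{2k}/K + 2ō^{2k}e^{βℓ}e^{-βNBt}`.
Proof: (5.3) (`moment_le_finiteVolume`) at `m = (f_Λ(0) - f_Λ(B))/B + t`, where the exponent
`Bm + f_Λ(B) - f_Λ(0)` equals `Bt`, and `0 ≤ m ≤ m_Λ(B) + t` by (4.6). [cite: KomaTasaki1993, Theorem 2.1, §4 (4.6), §5 (5.3)] -/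
theorem moment_le_magnetisation_add_pow [Nonempty n] (hN : 1 ≤ N) {β : ℝ} (hβ : 0 < β) {B : ℝ} (hB : 0 < B)
    {t : ℝ} (ht : 0 ≤ t) (k : ℕ) {ℓ : ℝ} (hℓ : 0 < ℓ) {K : ℕ} (hK : 1 ≤ K) :
    sys.moment β k ≤ (sys.magnetisation β B + t) ^ (2 * k) +
      32 * k ^ 3 * (2 * r * hb) ^ 2 * ob ^ (2 * k) * K ^ 2 / ℓ ^ 2 + 2 * ob ^ (2 * k) / K +
      2 * ob ^ (2 * k) * Real.exp (β * ℓ) * Real.exp (-(β * N * (B * t))) := by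
  set c : ℝ := (sys.freeEnergy β 0 - sys.freeEnergy β B) / B with hc_def
  have hc0 : 0 ≤ c := sys.freeEnergy_sub_div_nonneg hβ hB
  have hcm : c ≤ sys.magnetisation β B := sys.freeEnergy_sub_div_le_magnetisation hβ hB
  have hBc : B * c = sys.freeEnergy β 0 - sys.freeEnergy β B := by
    rw [hc_def, mul_div_cancel₀ _ hB.ne']
  have hfin := sys.moment_le_finiteVolume hN hβ hB.le (c + t) k hℓ hK
  have hexp : B * (c + t) + sys.freeEnergy β B - sys.freeEnergy β 0 = B * t := by
    rw [mul_add, hBc]; ring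
  rw [hexp] at hfin
  have hpow : (c + t) ^ (2 * k) ≤ (sys.magnetisation β B + t) ^ (2 * k) :=
    pow_le_pow_left₀ (by linarith) (by linarith) _
  linarith

/-- **THE `k = 1` CERTIFICATE FORM.**  If a number `s` satisfies `s ≤ N⁻²⟨O_Λ²⟩_Λ(0)` (a certified lower bound on
the thermal long-range order of the symmetric Gibbs state on THIS finite system), then for every `B > 0`, `t ≥ 0`,
`ℓ > 0`, `K ≥ 1`:
`m_Λ(B) ≥ √(s - [32(2rh̄)²ō²K²/ℓ² + 2ō²/K + 2ō²e^{βℓ}e^{-βNBt}]) - t`.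
[cite: KomaTasaki1993, Theorem 2.1, §4 (4.6), §5 (5.3)] -/
theorem sqrt_sub_le_magnetisation_add [Nonempty n] (hN : 1 ≤ N) {β : ℝ} (hβ : 0 < β) {B : ℝ} (hB : 0 < B)
    {t : ℝ} (ht : 0 ≤ t) {ℓ : ℝ} (hℓ : 0 < ℓ) {K : ℕ} (hK : 1 ≤ K) {s : ℝ} (hcert : s ≤ sys.moment β 1) :
    Real.sqrt (s - (32 * (2 * r * hb) ^ 2 * ob ^ 2 * K ^ 2 / ℓ ^ 2 + 2 * ob ^ 2 / K +
        2 * ob ^ 2 * Real.exp (β * ℓ) * Real.exp (-(β * N * (B * t))))) - t ≤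
      sys.magnetisation β B := by
  have h := sys.moment_le_magnetisation_add_pow hN hβ hB ht 1 hℓ hK
  simp only [Nat.cast_one, one_pow, mul_one] at h
  have hmt : 0 ≤ sys.magnetisation β B + t := add_nonneg (sys.magnetisation_nonneg hβ hB) ht
  have hsq : Real.sqrt (s - (32 * (2 * r * hb) ^ 2 * ob ^ 2 * K ^ 2 / ℓ ^ 2 + 2 * ob ^ 2 / K +
      2 * ob ^ 2 * Real.exp (β * ℓ) * Real.exp (-(β * N * (B * t))))) ≤ sys.magnetisation β B + t := by
    refine Real.sqrt_le_iff.mpr ⟨hmt, ?_⟩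
    linarith
  linarith

end KomaTasaki.Z2System

/-! ### §2. Quantum spins: the XXZ model on the torus `(ℤ/Lℤ)^d` -/

namespace XXZKT

open Literature.MathematicalPhysics.QuantumLattice.SpinOperators

variable {d : ℕ}

/-- **PLANAR XXZ MODEL / HARD-CORE BOSONS, ONE TORUS, `T > 0`: certified off-diagonal LRO ⟹ floor on the sourced
order parameter.**  On `Λ = (ℤ/Lℤ)^d` (`N = L^d`), `H = xxzHamiltonian n (torusGraph d L) J Δ` (any `J`, `Δ`, spin
`n/2`), `O = Sʸ_tot`: if `s ≤ N⁻² Σ_{x,y} Re⟨Sʸ_xSʸ_y⟩_β`, then for every `B > 0`, `t ≥ 0`, `ℓ > 0`, `K ≥ 1`,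
`N⁻¹ Re⟨Sʸ_tot⟩_{β, H - B·Sʸ_tot} ≥ √(s - E) - t`,
`E = 32(2rh̄)²ō²K²/ℓ² + 2ō²/K + 2ō²e^{βℓ}e^{-βNBt}`, `r = 2d+2`, `h̄ = hbar d n J Δ`, `ō = sNorm n = n/2+1`.
[cite: KomaTasaki1993, Theorem 2.1, (4.6), (5.3); §1 (1.1)] [cite: Tasaki2020, §4.3] -/
theorem xxz_thermal_sourcedOrder_ge_finiteVolume (L : ℕ) [NeZero L] (n : ℕ) (J Δ : ℝ) {β : ℝ} (hβ : 0 < β)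
    {B : ℝ} (hB : 0 < B) {t : ℝ} (ht : 0 ≤ t) {ℓ : ℝ} (hℓ : 0 < ℓ) {K : ℕ} (hK : 1 ≤ K) {s : ℝ}
    (hcert : s ≤ (∑ x : TorusSite d L, ∑ y : TorusSite d L, gibbsXXZCorrTorus 1 (d := d) β L n J Δ x y) /
      (Fintype.card (TorusSite d L) : ℝ) ^ 2) :
    Real.sqrt (s - (32 * (2 * ((2 * d + 2 : ℕ) : ℝ) * hbar d n J Δ) ^ 2 * sNorm n ^ 2 * K ^ 2 / ℓ ^ 2 +
        2 * sNorm n ^ 2 / K +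
        2 * sNorm n ^ 2 * Real.exp (β * ℓ) * Real.exp (-(β * Fintype.card (TorusSite d L) * (B * t))))) - t ≤
      (Fintype.card (TorusSite d L) : ℝ)⁻¹ *
        (gibbsState β (xxzHamiltonian n (torusGraph d L) J Δ - (B : ℂ) • totalSpin n 1) (totalSpin n 1)).re := by
  have hc : s ≤ (z2System d L n J Δ).moment β 1 := by rwa [z2System_moment_one]
  have h := (z2System d L n J Δ).sqrt_sub_le_magnetisation_add Fintype.card_pos hβ hB ht hℓ hK hc
  rwa [z2System_magnetisation] at h

/-- **XXZ ANTIFERROMAGNET, STAGGERED PLANAR ORDER PARAMETER, ONE TORUS, `T > 0`.**  `O = Σ_x(-1)^xSˣ_x` on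
`(ℤ/Lℤ)^d`: if `s ≤ N⁻² Σ_{x,y}(-1)^x(-1)^y Re⟨Sˣ_xSˣ_y⟩_β` then for every `B > 0`, `t ≥ 0`, `ℓ > 0`, `K ≥ 1`,
`N⁻¹ Re⟨O⟩_{β, H - B·O} ≥ √(s - E) - t` with the same `E`. [cite: KomaTasaki1993, Theorem 2.1, (4.6), (5.3); §1 (1.7)–(1.8)] -/
theorem xxzAF_thermal_sourcedStaggeredOrder_ge_finiteVolume (L : ℕ) [NeZero L] (n : ℕ) (J Δ : ℝ) {β : ℝ}
    (hβ : 0 < β) {B : ℝ} (hB : 0 < B) {t : ℝ} (ht : 0 ≤ t) {ℓ : ℝ} (hℓ : 0 < ℓ) {K : ℕ} (hK : 1 ≤ K) {s : ℝ}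
    (hcert : s ≤ (∑ x : TorusSite d L, ∑ y : TorusSite d L,
        (-1 : ℝ) ^ (∑ i, (x i).val) * (-1) ^ (∑ i, (y i).val) * gibbsXXZCorrTorus 0 (d := d) β L n J Δ x y) /
      (Fintype.card (TorusSite d L) : ℝ) ^ 2) :
    Real.sqrt (s - (32 * (2 * ((2 * d + 2 : ℕ) : ℝ) * hbar d n J Δ) ^ 2 * sNorm n ^ 2 * K ^ 2 / ℓ ^ 2 +
        2 * sNorm n ^ 2 / K +
        2 * sNorm n ^ 2 * Real.exp (β * ℓ) * Real.exp (-(β * Fintype.card (TorusSite d L) * (B * t))))) - t ≤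
      (Fintype.card (TorusSite d L) : ℝ)⁻¹ *
        (gibbsState β (xxzHamiltonian n (torusGraph d L) J Δ - (B : ℂ) • stagSpin n (torusParityExp d L) 0)
          (stagSpin n (torusParityExp d L) 0)).re := by
  have hc : s ≤ (afZ2System d L n J Δ).moment β 1 := by rwa [afZ2System_moment_one]
  have h := (afZ2System d L n J Δ).sqrt_sub_le_magnetisation_add Fintype.card_pos hβ hB ht hℓ hK hc
  rwa [afZ2System_magnetisation] at h

/-- **XXZ ANTIFERROMAGNET, NÉEL ORDER PARAMETER, ONE TORUS, `T > 0`** (the non-commuting order parameter of KT93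
Theorem 2.1).  `O = Σ_x(-1)^xSᶻ_x` on `(ℤ/Lℤ)^d`: if `s ≤ N⁻² Σ_{x,y}(-1)^x(-1)^y Re⟨Sᶻ_xSᶻ_y⟩_β` then for every
`B > 0`, `t ≥ 0`, `ℓ > 0`, `K ≥ 1`, `N⁻¹ Re⟨O⟩_{β, H - B·O} ≥ √(s - E) - t` with the same `E`.
[cite: KomaTasaki1993, Theorem 2.1, (4.6), (5.3); §1 (1.7)–(1.8)] [cite: Tasaki2020, §4.3] -/
theorem xxzAF_thermal_sourcedNeelOrder_ge_finiteVolume (L : ℕ) [NeZero L] (n : ℕ) (J Δ : ℝ) {β : ℝ}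
    (hβ : 0 < β) {B : ℝ} (hB : 0 < B) {t : ℝ} (ht : 0 ≤ t) {ℓ : ℝ} (hℓ : 0 < ℓ) {K : ℕ} (hK : 1 ≤ K) {s : ℝ}
    (hcert : s ≤ (∑ x : TorusSite d L, ∑ y : TorusSite d L,
        (-1 : ℝ) ^ (∑ i, (x i).val) * (-1) ^ (∑ i, (y i).val) * gibbsXXZCorrTorus 2 (d := d) β L n J Δ x y) /
      (Fintype.card (TorusSite d L) : ℝ) ^ 2) :
    Real.sqrt (s - (32 * (2 * ((2 * d + 2 : ℕ) : ℝ) * hbar d n J Δ) ^ 2 * sNorm n ^ 2 * K ^ 2 / ℓ ^ 2 +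
        2 * sNorm n ^ 2 / K +
        2 * sNorm n ^ 2 * Real.exp (β * ℓ) * Real.exp (-(β * Fintype.card (TorusSite d L) * (B * t))))) - t ≤
      (Fintype.card (TorusSite d L) : ℝ)⁻¹ *
        (gibbsState β (xxzHamiltonian n (torusGraph d L) J Δ - (B : ℂ) • stagSpin n (torusParityExp d L) 2)
          (stagSpin n (torusParityExp d L) 2)).re := by
  have hc : s ≤ (isingAFZ2System d L n J Δ).moment β 1 := by rwa [isingAFZ2System_moment_one]
  have h := (isingAFZ2System d L n J Δ).sqrt_sub_le_magnetisation_add Fintype.card_pos hβ hB ht hℓ hK hc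
  rwa [isingAFZ2System_magnetisation] at h

end XXZKT


end Literature.MathematicalPhysics.QuantumLattice
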